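import Mathlib
import Summits.ValiantsHypothesis.ValiantsHypothesis.Theses.BarrierLever
import Summits.ValiantsHypothesis.ValiantsHypothesis.Theorems.BarrierLeverDefinableEquationsDefs
import Summits.ValiantsHypothesis.ValiantsHypothesis.Theorems.BarrierLeverDefinableEquationsStubRazTopUniversality
import Summits.ValiantsHypothesis.ValiantsHypothesis.Theorems.BarrierLeverDefinableEquationsShiftInN
import Literature.Computability.AlgebraicComplexity.ArithCircuitProofs
import Literature.Computability.AlgebraicComplexity.IMMInVPProofs

/-!
# Crux `BarrierLever.DefinableEquations` (stmt-ValiantsHypothesis-8745) — NORMAL FORM: the crux is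
# equivalent to its restriction to TOP homogeneous components (lead c6)

Write `Eq(n, b, a)` for the crux's inner statement at one `n` (a nonzero level-`a` boolean sum in
the `N = C(2n,n)` coefficient variables `degLEMonomials n`, vanishing at `coeff(f)` for every
`f ∈ SmallCircuits ℂ n b`) and `TopEq(n, b, a)` for the same statement written on the coordinates
`topMonomials n` of `Sym^n ℂ^n` only: a nonzero level-`a` boolean sum in the degree-EXACTLY-`n`
coefficient variables vanishing at the top homogeneous component `(coeff_e f)_{|e| = n}` of every
`f ∈ SmallCircuits ℂ n b`.

THEOREM (`definableEquations_iff_topEquations`, registered sub-goal; inner name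
`TopEquations.definableEquations_iff`).
`DefinableEquations ↔ ∃ a ∀ b ∃ n₀ ∀ n ≥ n₀, TopEq(n, b, a)`.

* `TopEq(n, b, a) → Eq(n, b, a)` (`TopEquations.eq_of_topEq`): rename the witness along the
  inclusion `topMonomials n ↪ degLEMonomials n` (`boolSum_rename_sumMap`, `rename_injective`,
  `complexity_rename_le`).
* `Eq(n, b+4, a) → TopEq(n+1, b, a)` for `n ≥ 2^(b+4)` (`TopEquations.topEq_succ_of_eq`),
  by DEHOMOGENISATION: for `h ∈ SmallCircuits ℂ (n+1) b` let `h' = h_{n+1}` be its top component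
  (cheap: `SqrtCheap.complexity_homogeneousComponent_le`) and `f = h'(1, x) - h'(0, x)` in the
  `n` variables `x = (x₂, …, x_{n+1})`; then `deg f ≤ n`, `L(f) ≤ 2 L(h') + 2`, so
  `f ∈ SmallCircuits ℂ n (b+4)`, and `coeff_m(f) = coeff_{(n+1-|m|, m)}(h)` for every `m` of degree
  `≤ n` (`TopEquations.exists_dehomogenize`, via `MvPolynomial.finSuccEquiv`).  The exponent map
  `m ↦ (n+1-|m|, m)` is an injection `degLEMonomials n ↪ topMonomials (n+1)` (a bijection onto the
  top monomials divisible by `x₁`), so a witness at `n` renamed along it is a top witness at `n+1`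
  (budgets transfer by `C(2n,n) ≤ C(2n+2,n+1)`).

So the crux IS the statement "uniform (one level `a` for every `b`) VNP(N)-explicit equations for
the variety of degree-`n` FORMS in `n` variables of circuit size `≤ n^b`": nothing is lost by
restricting to top components (the informal standing claim of leads c1–c5, now kernel-checked).
A boolean-sum annihilator of Raz's map on the top monomials is a top equation
(`TopEquations.topEq_of_razAnn`, by `stub_razTopUniversality`; the uniform statement is treated in
`…RazAnnihilators.lean`), and the infinitely-often forms (what the assembly consumes, file
`…InfinitelyOften.lean`) correspond likewise (`definableEquations_io_iff_topEquations_io`).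
Pure bookkeeping over the tree's definitions; no definitions, no facts.
-/

set_option linter.dupNamespace false

noncomputable section

namespace Summit.ValiantsHypothesis.ValiantsHypothesis.Theorems.BarrierLeverDefinableEquations

open MvPolynomial
open Literature.Computability.AlgebraicComplexity Literature.Barriers.ValiantsHypothesis
open scoped BigOperators

namespace TopEquations

/-! ## Top equations give equations (same `n`, same level) -/

/-- `TopEq(n, b, a) → Eq(n, b, a)`: rename a top witness along `topIncl n`. [folklore] -/
theorem eq_of_topEq {a b n : ℕ}
    (h : ∃ q : ℕ, q ≤ (Nat.choose (2 * n) n) ^ a ∧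
      ∃ H : MvPolynomial (↥(topMonomials n) ⊕ Fin q) ℂ,
        complexity H ≤ (Nat.choose (2 * n) n) ^ a ∧ H.totalDegree ≤ (Nat.choose (2 * n) n) ^ a ∧
        boolSum H ≠ 0 ∧
        ∀ f ∈ SmallCircuits ℂ n b,
          eval (fun e : topMonomials n => coeff (e : Fin n →₀ ℕ) f) (boolSum H) = 0) :
    ∃ q : ℕ, q ≤ (Nat.choose (2 * n) n) ^ a ∧
      ∃ H : MvPolynomial (↥(degLEMonomials n) ⊕ Fin q) ℂ,
        complexity H ≤ (Nat.choose (2 * n) n) ^ a ∧ H.totalDegree ≤ (Nat.choose (2 * n) n) ^ a ∧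
        boolSum H ≠ 0 ∧
        ∀ f ∈ SmallCircuits ℂ n b, eval (coeffVector (degLEMonomials n) f) (boolSum H) = 0 := by
  obtain ⟨q, hq, H, hHc, hHd, hne, hvan⟩ := h
  refine ⟨q, hq, MvPolynomial.rename (Sum.map (topIncl n) id) H, ?_, ?_, ?_, ?_⟩
  · exact (complexity_rename_le_holds' _ _).trans hHc
  · exact (MvPolynomial.totalDegree_rename_le _ _).trans hHd
  · rw [boolSum_rename_sumMap]
    exact fun hz => hne (MvPolynomial.rename_injective _ (topIncl_injective n) (by rw [hz, map_zero]))
  · intro f hf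
    rw [boolSum_rename_sumMap, MvPolynomial.eval_rename]
    have hcoe : (coeffVector (degLEMonomials n) f) ∘ topIncl n =
        fun e : topMonomials n => coeff (e : Fin n →₀ ℕ) f := by
      funext e
      rfl
    rw [hcoe]
    exact hvan f hf

/-- A Raz annihilator is a top equation (`n ≥ 1`): the top coefficients of every
`f ∈ SmallCircuits ℂ n b` form a Raz point (`stub_razTopUniversality`). [folklore] -/
theorem topEq_of_razAnn {a b n : ℕ} (hn : 1 ≤ n)
    (h : ∃ q : ℕ, q ≤ (Nat.choose (2 * n) n) ^ a ∧
      ∃ H : MvPolynomial (↥(topMonomials n) ⊕ Fin q) ℂ,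
        complexity H ≤ (Nat.choose (2 * n) n) ^ a ∧ H.totalDegree ≤ (Nat.choose (2 * n) n) ^ a ∧
        boolSum H ≠ 0 ∧
        ∀ y : RazUniversal.Lab (Fin n) n (razSlots n b) → ℂ, eval (razPoint n b y) (boolSum H) = 0) :
    ∃ q : ℕ, q ≤ (Nat.choose (2 * n) n) ^ a ∧
      ∃ H : MvPolynomial (↥(topMonomials n) ⊕ Fin q) ℂ,
        complexity H ≤ (Nat.choose (2 * n) n) ^ a ∧ H.totalDegree ≤ (Nat.choose (2 * n) n) ^ a ∧
        boolSum H ≠ 0 ∧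
        ∀ f ∈ SmallCircuits ℂ n b,
          eval (fun e : topMonomials n => coeff (e : Fin n →₀ ℕ) f) (boolSum H) = 0 := by
  obtain ⟨q, hq, H, hHc, hHd, hne, hvan⟩ := h
  refine ⟨q, hq, H, hHc, hHd, hne, fun f hf => ?_⟩
  obtain ⟨y, hy⟩ := stub_razTopUniversality n b hn f hf
  have hpt : (fun e : topMonomials n => coeff (e : Fin n →₀ ℕ) f) = razPoint n b y :=
    funext fun e => (hy e).symm
  rw [hpt]
  exact hvan y

/-! ## Dehomogenisation: equations at `n` give top equations at `n + 1` -/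

/-- Degree of a `cons`-extended exponent: `|(i, m)| = i + |m|`. [folklore] -/
theorem degree_cons {n : ℕ} (i : ℕ) (m : Fin n →₀ ℕ) :
    (Finsupp.cons i m : Fin (n + 1) →₀ ℕ).degree = i + m.degree := by
  rw [Finsupp.degree_eq_sum, Finsupp.degree_eq_sum, Fin.sum_univ_succ]
  simp only [Finsupp.cons_zero, Finsupp.cons_succ]

/-- Substituting a polynomial `q` for the first variable is evaluation at `q` of the
`finSuccEquiv` image. [folklore] -/
theorem aeval_finCases_eq (n : ℕ) (g : MvPolynomial (Fin (n + 1)) ℂ) (q : MvPolynomial (Fin n) ℂ) :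
    aeval (Fin.cases q X : Fin (n + 1) → MvPolynomial (Fin n) ℂ) g =
      Polynomial.eval q (finSuccEquiv ℂ n g) := by
  rw [finSuccEquiv_apply, coe_eval₂Hom, polynomial_eval_eval₂, aeval_def]
  congr 1
  · ext r
    simp
  · funext i
    refine Fin.cases ?_ (fun j => ?_) i <;> simp

/-- Substituting a constant for the first variable does not increase the complexity
(`complexity_aeval_le`; variables and constants are free). [folklore] -/
theorem complexity_aeval_finCases_C_le (n : ℕ) (g : MvPolynomial (Fin (n + 1)) ℂ) (c : ℂ) :
    complexity (aeval (Fin.cases (C c) X : Fin (n + 1) → MvPolynomial (Fin n) ℂ) g) ≤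
      complexity g := by
  have hX : ∀ i : Fin n, complexity (X i : MvPolynomial (Fin n) ℂ) = 0 := complexity_X_holds
  have hC : complexity (C c : MvPolynomial (Fin n) ℂ) = 0 := complexity_C_holds c
  refine (complexity_aeval_le _ _).trans (le_of_eq ?_)
  rw [Fin.sum_univ_succ]
  simp only [Fin.cases_zero, Fin.cases_succ, hX, hC, Finset.sum_const_zero, add_zero]

/-- Arithmetic for the dehomogenisation step: for `n ≥ 2^(b+4)`,
`2 ((n+2) ((n+1)^b + (n+1) + 2)) + 2 ≤ n^(b+4)`. [folklore] -/
theorem dehom_arith {n b : ℕ} (hn : 2 ^ (b + 4) ≤ n) :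
    2 * ((n + 2) * ((n + 1) ^ b + (n + 1) + 2)) + 2 ≤ n ^ (b + 4) := by
  have h16 : 16 ≤ n := le_trans (by
    calc (16 : ℕ) = 2 ^ 4 := by norm_num
      _ ≤ 2 ^ (b + 4) := Nat.pow_le_pow_right (by norm_num) (by omega)) hn
  set B := (n + 1) ^ b + n + 2 with hB
  have hB1 : 1 ≤ B := by omega
  have hA : (n + 1) ^ b + (n + 1) + 2 = B + 1 := by omega
  rw [hA]
  refine le_trans ?_ (ShiftInN.restrict_arith hn)
  calc 2 * ((n + 2) * (B + 1)) + 2 = 2 * ((n + 2) * B) + (2 * (n + 2) + 2) := by ring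
    _ ≤ 2 * ((n + 2) * B) + 15 * ((n + 2) * B) := by
        refine Nat.add_le_add_left ?_ _
        calc 2 * (n + 2) + 2 ≤ 15 * (n + 2) := by omega
          _ = 15 * ((n + 2) * 1) := by ring
          _ ≤ 15 * ((n + 2) * B) := Nat.mul_le_mul_left _ (Nat.mul_le_mul_left _ hB1)
    _ = 17 * ((n + 2) * B) := by ring
    _ ≤ (n + 1) * ((n + 2) * B) := Nat.mul_le_mul_right _ (by omega)
    _ ≤ (n + 1) * ((n + 2) * B) + (n + 1) := Nat.le_add_right _ _

/-- **Dehomogenisation.**  For `n ≥ 2^(b+4)` and `h ∈ SmallCircuits ℂ (n+1) b` there is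
`f ∈ SmallCircuits ℂ n (b+4)` (namely `h'(1,x) - h'(0,x)`, `h'` the top component of `h`) with
`coeff_m(f) = coeff_{(n+1-|m|, m)}(h)` for every exponent `m` of degree `≤ n`. [folklore] -/
theorem exists_dehomogenize {n b : ℕ} (hn : 2 ^ (b + 4) ≤ n) (h : MvPolynomial (Fin (n + 1)) ℂ)
    (hh : h ∈ SmallCircuits ℂ (n + 1) b) :
    ∃ f ∈ SmallCircuits ℂ n (b + 4), ∀ m : Fin n →₀ ℕ, m.degree ≤ n →
      coeff m f = coeff (Finsupp.cons (n + 1 - m.degree) m) h := by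
  classical
  obtain ⟨hhdeg, hhc⟩ := hh
  -- the top component and its size
  set h' : MvPolynomial (Fin (n + 1)) ℂ := homogeneousComponent (n + 1) h with hh'
  have hh'c : complexity h' ≤ (n + 2) * ((n + 1) ^ b + (n + 1) + 2) := by
    have h1 := Summit.ValiantsHypothesis.ValiantsHypothesis.Theorems.DivisionGapZeroOneTransfer.SqrtCheap.complexity_homogeneousComponent_le
      h hhdeg (n + 1)
    rw [Fintype.card_fin] at h1
    refine h1.trans ?_
    exact Nat.mul_le_mul (by omega) (by omega)
  have hh'deg : h'.totalDegree ≤ n + 1 := (homogeneousComponent_isHomogeneous (n + 1) h).totalDegree_le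
  -- `f = h'(1, x) - h'(0, x)`
  set P : Polynomial (MvPolynomial (Fin n) ℂ) := finSuccEquiv ℂ n h' with hP
  set f : MvPolynomial (Fin n) ℂ :=
    aeval (Fin.cases (C 1) X : Fin (n + 1) → MvPolynomial (Fin n) ℂ) h' +
      (-1 : ℂ) • aeval (Fin.cases (C 0) X : Fin (n + 1) → MvPolynomial (Fin n) ℂ) h' with hf
  -- `f` as a sum of the positive-index coefficients of `P`
  have hPdeg : P.natDegree < n + 2 := by
    rw [hP, natDegree_finSuccEquiv]
    exact Nat.lt_succ_of_le ((degreeOf_le_totalDegree h' 0).trans hh'deg)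
  have hfsum : f = ∑ i ∈ (Finset.range (n + 2)).erase 0, P.coeff i := by
    rw [hf, aeval_finCases_eq, aeval_finCases_eq, ← hP, C_1, C_0,
      ← Polynomial.coeff_zero_eq_eval_zero, Polynomial.eval_eq_sum_range' hPdeg,
      Finset.sum_erase_eq_sub (Finset.mem_range.2 (by omega))]
    simp only [one_pow, mul_one, neg_one_smul]
    ring
  -- coefficients of `f`
  have hcoeff : ∀ m : Fin n →₀ ℕ, m.degree ≤ n →
      coeff m f = coeff (Finsupp.cons (n + 1 - m.degree) m) h := by
    intro m hm
    rw [hfsum, coeff_sum]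
    simp only [hP, finSuccEquiv_coeff_coeff, hh', coeff_homogeneousComponent, degree_cons]
    rw [Finset.sum_ite, Finset.sum_const_zero, add_zero]
    have hfilter : ((Finset.range (n + 2)).erase 0).filter (fun i => i + m.degree = n + 1) =
        {n + 1 - m.degree} := by
      ext i
      simp only [Finset.mem_filter, Finset.mem_erase, Finset.mem_range, Finset.mem_singleton]
      omega
    rw [hfilter, Finset.sum_singleton]
  refine ⟨f, ⟨?_, ?_⟩, hcoeff⟩
  · -- degree ≤ n
    rw [hfsum]
    refine totalDegree_finsetSum_le fun i hi => ?_
    have hi1 : 1 ≤ i := by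
      have := Finset.ne_of_mem_erase hi
      omega
    by_cases hPi : P.coeff i = 0
    · rw [hPi, totalDegree_zero]; exact Nat.zero_le _
    · have := totalDegree_coeff_finSuccEquiv_add_le h' i (by rwa [hP] at hPi)
      rw [← hP] at this
      omega
  · -- size ≤ n^(b+4)
    calc complexity f
        ≤ complexity (aeval (Fin.cases (C 1) X : Fin (n + 1) → MvPolynomial (Fin n) ℂ) h') +
            complexity ((-1 : ℂ) • aeval (Fin.cases (C 0) X : Fin (n + 1) → MvPolynomial (Fin n) ℂ) h') +
            1 := complexity_add_le_holds _ _
      _ ≤ complexity h' + (complexity h' + 1) + 1 := by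
          gcongr
          · exact complexity_aeval_finCases_C_le n h' 1
          · exact (complexity_smul_le_holds _ _).trans
              (Nat.add_le_add_right (complexity_aeval_finCases_C_le n h' 0) 1)
      _ = 2 * complexity h' + 2 := by ring
      _ ≤ 2 * ((n + 2) * ((n + 1) ^ b + (n + 1) + 2)) + 2 := by gcongr
      _ ≤ n ^ (b + 4) := dehom_arith hn

/-- **Equations at `n` give top equations at `n+1`.**  For `n ≥ 2^(b+4)`: a nonzero level-`a`
boolean-sum equation against `SmallCircuits ℂ n (b+4)` yields (same level `a`, same `q`) a nonzero
boolean sum in the TOP coefficient variables of `n+1`-variate polynomials vanishing at the top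
component of every `h ∈ SmallCircuits ℂ (n+1) b` — rename the witness along `m ↦ (n+1-|m|, m)` and feed it
the dehomogenisation `f` of `exists_dehomogenize`. [folklore] -/
theorem topEq_succ_of_eq {a b n : ℕ} (hn : 2 ^ (b + 4) ≤ n)
    (h : ∃ q : ℕ, q ≤ (Nat.choose (2 * n) n) ^ a ∧
      ∃ H : MvPolynomial (↥(degLEMonomials n) ⊕ Fin q) ℂ,
        complexity H ≤ (Nat.choose (2 * n) n) ^ a ∧ H.totalDegree ≤ (Nat.choose (2 * n) n) ^ a ∧
        boolSum H ≠ 0 ∧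
        ∀ f ∈ SmallCircuits ℂ n (b + 4), eval (coeffVector (degLEMonomials n) f) (boolSum H) = 0) :
    ∃ q : ℕ, q ≤ (Nat.choose (2 * (n + 1)) (n + 1)) ^ a ∧
      ∃ H : MvPolynomial (↥(topMonomials (n + 1)) ⊕ Fin q) ℂ,
        complexity H ≤ (Nat.choose (2 * (n + 1)) (n + 1)) ^ a ∧
        H.totalDegree ≤ (Nat.choose (2 * (n + 1)) (n + 1)) ^ a ∧
        boolSum H ≠ 0 ∧
        ∀ g ∈ SmallCircuits ℂ (n + 1) b,
          eval (fun e : topMonomials (n + 1) => coeff (e : Fin (n + 1) →₀ ℕ) g) (boolSum H) = 0 := by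
  classical
  obtain ⟨q, hq, H, hHc, hHd, hne, hvan⟩ := h
  have hN : (Nat.choose (2 * n) n) ^ a ≤ (Nat.choose (2 * (n + 1)) (n + 1)) ^ a :=
    Nat.pow_le_pow_left (ShiftInN.centralChoose_le_succ n) a
  -- the exponent injection `degLEMonomials n ↪ topMonomials (n+1)`, `m ↦ (n + 1 - |m|, m)`
  let ι : ↥(degLEMonomials n) → ↥(topMonomials (n + 1)) := fun m =>
    ⟨Finsupp.cons (n + 1 - (m : Fin n →₀ ℕ).degree) (m : Fin n →₀ ℕ), by
      have hm : (m : Fin n →₀ ℕ).degree ≤ n := m.2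
      show (Finsupp.cons (n + 1 - (m : Fin n →₀ ℕ).degree) (m : Fin n →₀ ℕ)).degree = n + 1
      rw [degree_cons]
      omega⟩
  have hι : Function.Injective ι := by
    intro x y hxy
    apply Subtype.ext
    have h1 := congrArg (fun e : ↥(topMonomials (n + 1)) => Finsupp.tail (e : Fin (n + 1) →₀ ℕ)) hxy
    simpa [ι, Finsupp.tail_cons] using h1
  refine ⟨q, hq.trans hN, MvPolynomial.rename (Sum.map ι id) H, ?_, ?_, ?_, ?_⟩
  · exact (complexity_rename_le_holds' _ _).trans (hHc.trans hN)
  · exact (MvPolynomial.totalDegree_rename_le _ _).trans (hHd.trans hN)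
  · rw [boolSum_rename_sumMap]
    exact fun hz => hne (MvPolynomial.rename_injective ι hι (by rw [hz, map_zero]))
  · intro g hg
    rw [boolSum_rename_sumMap, MvPolynomial.eval_rename]
    obtain ⟨f, hf, hcoeff⟩ := exists_dehomogenize hn g hg
    have hcoe : (fun e : topMonomials (n + 1) => coeff (e : Fin (n + 1) →₀ ℕ) g) ∘ ι =
        coeffVector (degLEMonomials n) f := by
      funext m
      simp only [Function.comp_apply, coeffVector_apply, ι]
      exact (hcoeff _ m.2).symm
    rw [hcoe]
    exact hvan f hf

end TopEquations

/-! ## The normal form -/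

/-- **The crux is equivalent to its top-component form** (registered sub-goal, lead c6):
`DefinableEquations ↔ ∃ a ∀ b ∃ n₀ ∀ n ≥ n₀, TopEq(n, b, a)` — one level `a` of nonzero boolean-sum
equations, for every `b` and all large `n`, in the coefficient variables of `Sym^n ℂ^n` only,
vanishing at the top homogeneous component of every `f ∈ SmallCircuits ℂ n b`.  (`→`:
dehomogenisation `TopEquations.topEq_succ_of_eq` at `b + 4`, from `n - 1 ≥ max n₀ 2^(b+4)`;
`←`: `TopEquations.eq_of_topEq`.) [folklore] -/
theorem TopEquations.definableEquations_iff :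
    Summit.ValiantsHypothesis.ValiantsHypothesis.Theses.BarrierLever.DefinableEquations ↔
      ∃ a : ℕ, ∀ b : ℕ, ∃ n₀ : ℕ, ∀ n ≥ n₀, ∃ q : ℕ, q ≤ (Nat.choose (2 * n) n) ^ a ∧
        ∃ H : MvPolynomial (↥(topMonomials n) ⊕ Fin q) ℂ,
          complexity H ≤ (Nat.choose (2 * n) n) ^ a ∧ H.totalDegree ≤ (Nat.choose (2 * n) n) ^ a ∧
          boolSum H ≠ 0 ∧
          ∀ f ∈ SmallCircuits ℂ n b,
            eval (fun e : topMonomials n => coeff (e : Fin n →₀ ℕ) f) (boolSum H) = 0 := by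
  constructor
  · rintro ⟨a, ha⟩
    refine ⟨a, fun b => ?_⟩
    obtain ⟨n₀, hn₀⟩ := ha (b + 4)
    refine ⟨max n₀ (2 ^ (b + 4)) + 1, fun n hn => ?_⟩
    obtain ⟨n', rfl⟩ : ∃ n', n = n' + 1 := ⟨n - 1, by omega⟩
    have hmax : max n₀ (2 ^ (b + 4)) ≤ n' := by omega
    have h1 : n₀ ≤ n' := le_trans (le_max_left _ _) hmax
    have h2 : 2 ^ (b + 4) ≤ n' := le_trans (le_max_right _ _) hmax
    exact TopEquations.topEq_succ_of_eq h2 (hn₀ n' h1)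
  · rintro ⟨a, ha⟩
    refine ⟨a, fun b => ?_⟩
    obtain ⟨n₀, hn₀⟩ := ha b
    exact ⟨n₀, fun n hn => TopEquations.eq_of_topEq (hn₀ n hn)⟩

/-! ## The infinitely-often forms correspond too

The assembly consumes only `DefEq_io` (one level `a`, every `b`, infinitely often in `n`; file
`…InfinitelyOften.lean`).  The same two transfers give the top-component normal form of
`DefEq_io`. -/

/-- **`DefEq_io ↔ TopEq_io`.** [folklore] -/
theorem definableEquations_io_iff_topEquations_io :
    (∃ a : ℕ, ∀ b n₀ : ℕ, ∃ n : ℕ, n₀ ≤ n ∧ ∃ q : ℕ, q ≤ (Nat.choose (2 * n) n) ^ a ∧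
      ∃ H : MvPolynomial (↥(degLEMonomials n) ⊕ Fin q) ℂ,
        complexity H ≤ (Nat.choose (2 * n) n) ^ a ∧ H.totalDegree ≤ (Nat.choose (2 * n) n) ^ a ∧
        boolSum H ≠ 0 ∧
        ∀ f ∈ SmallCircuits ℂ n b, eval (coeffVector (degLEMonomials n) f) (boolSum H) = 0) ↔
    (∃ a : ℕ, ∀ b n₀ : ℕ, ∃ n : ℕ, n₀ ≤ n ∧ ∃ q : ℕ, q ≤ (Nat.choose (2 * n) n) ^ a ∧
      ∃ H : MvPolynomial (↥(topMonomials n) ⊕ Fin q) ℂ,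
        complexity H ≤ (Nat.choose (2 * n) n) ^ a ∧ H.totalDegree ≤ (Nat.choose (2 * n) n) ^ a ∧
        boolSum H ≠ 0 ∧
        ∀ f ∈ SmallCircuits ℂ n b,
          eval (fun e : topMonomials n => coeff (e : Fin n →₀ ℕ) f) (boolSum H) = 0) := by
  constructor
  · rintro ⟨a, ha⟩
    refine ⟨a, fun b n₀ => ?_⟩
    obtain ⟨n, hn, hrest⟩ := ha (b + 4) (max n₀ (2 ^ (b + 4)))
    have h1 : n₀ ≤ n := le_trans (le_max_left _ _) hn
    have h2 : 2 ^ (b + 4) ≤ n := le_trans (le_max_right _ _) hn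
    exact ⟨n + 1, by omega, TopEquations.topEq_succ_of_eq h2 hrest⟩
  · rintro ⟨a, ha⟩
    refine ⟨a, fun b n₀ => ?_⟩
    obtain ⟨n, hn, hrest⟩ := ha b n₀
    exact ⟨n, hn, TopEquations.eq_of_topEq hrest⟩

/-- **Registered sub-goal `definableEquations_iff_topEquations` (verbatim signature).**  The crux is
equivalent to its top-component form (`TopEquations.definableEquations_iff`). [folklore] -/
theorem definableEquations_iff_topEquations : Summit.ValiantsHypothesis.ValiantsHypothesis.Theses.BarrierLever.DefinableEquations ↔ ∃ a : ℕ, ∀ b : ℕ, ∃ n₀ : ℕ, ∀ n ≥ n₀, ∃ q : ℕ, q ≤ (Nat.choose (2 * n) n) ^ a ∧ ∃ H : MvPolynomial (↥(Summit.ValiantsHypothesis.ValiantsHypothesis.Theorems.BarrierLeverDefinableEquations.topMonomials n) ⊕ Fin q) ℂ, Literature.Computability.AlgebraicComplexity.complexity H ≤ (Nat.choose (2 * n) n) ^ a ∧ H.totalDegree ≤ (Nat.choose (2 * n) n) ^ a ∧ Literature.Computability.AlgebraicComplexity.boolSum H ≠ 0 ∧ ∀ f ∈ Literature.Barriers.ValiantsHypothesis.SmallCircuits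 ℂ n b, MvPolynomial.eval (fun e : ↥(Summit.ValiantsHypothesis.ValiantsHypothesis.Theorems.BarrierLeverDefinableEquations.topMonomials n) => MvPolynomial.coeff (e : Fin n →₀ ℕ) f) (Literature.Computability.AlgebraicComplexity.boolSum H) = 0 :=
  TopEquations.definableEquations_iff

end Summit.ValiantsHypothesis.ValiantsHypothesis.Theorems.BarrierLeverDefinableEquations

end
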